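import Summits.BirchSwinnertonDyer.BirchSwinnertonDyer.Theorems.GoldfeldAllTwistsTwoConverseTwinInertSevenPartnerLocal
import HarnessLib

set_option linter.dupNamespace false -- namespace `…BirchSwinnertonDyer.BirchSwinnertonDyer…` is the cell's (D-0017 nested layout)
set_option autoImplicit false

/-!
# Twin″ (item 19140), 7-INERT half: the COMPLEMENTARITY LAW in the kernel (Selmer level)

Cell `bsd-goldfeld`, seat `bsd-goldfeld-s1p-c301` (prover, gen 13); `--supports stmt-BirchSwinnertonDyer-19140` (twin″) as a
HELPER; sequel of `…TwinInertSevenSplitSymbol[Families]` (place `ℓ`) and `…TwinInertSevenPartnerLocal` (places `∞, 2, 7, a`).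
`ℓ ≡ 5 (mod 8)` prime with `(−7/ℓ) = 1` (so `49a1^{(−ℓ)} ∈ 𝒮`, the 7-inert half); models `E_M : y² = x³ + 21M x² + 112M² x
≅ 49a1^{(M)}`, `S(M) = twoIsogenySelmerGroup (21M) (112M²)`, `S'(M) = twoIsogenySelmerGroup (−42M) (−7M²)`:
* **`selmer_posTwist_subset_of_symbol_neg`**: `σ(ℓ) = −1` ⇒ `S(ℓ) ⊆ {1,7}`, `S'(ℓ) ⊆ {1,−7}`;
* **`selmer_auxTwist_subset_of_symbol_pos`**: `σ(ℓ) = +1`, `a ≡ 1 (mod 8)` prime, `−7 ∉ 𝔽_a²`, `a ∉ 𝔽_ℓ²` ⇒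
  `S(aℓ) ⊆ {1,7}`, `S'(aℓ) ⊆ {1,−7}`
(`σ(ℓ) = ±1` stated choice-free over all `s` with `s² = −7`; exhaustive by the symbol coincidence). So for EVERY `ℓ ∈ 𝒮`
and every admissible `a` exactly one of the two GOOD-reduction partners has minimal `2`-isogeny Selmer sets; the steps to
`rank 0 ∧ Ш[2] = 0` (`two_pow_twoIsogenySelmerRank_add_eq`) and to `L(49a1^{(M)},1) ≠ 0` / `ord₂ L^{alg}` (Burungale–Tian,
Burungale–Flach) are left to consumers (memo `HOME/INERT7-AUXPRIME-HORIZON.md` §2–§3; kit j288158 certifies `ℓ < 6000`).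
HONEST FRAMING: Selmer sets of auxiliary twists outside the cell; nothing about `L`-values; no case of twin″/K12₂″ decided;
BSD is not proved by any of this.
References: Silverman, *AEC* (2009), X.4.9 [SilvermanAEC2009]; Zywina, arXiv:2502.01957, Lemma 3.1 [Zywina2025].
-/

noncomputable section

open scoped Classical

open WeierstrassCurve Literature.NumberTheory.EllipticCurves
open Literature.NumberTheory.EllipticCurves.Zywina2025 (exists_padicInt_of_isSoluble
  isSquare_zmod_of_isSoluble_padic)

namespace Summit.BirchSwinnertonDyer.BirchSwinnertonDyer.Theorems.GoldfeldGoodTwists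

/-! ## §4. `σ(ℓ) = −1`: the Selmer sets of the partner `49a1^{(ℓ)}` are minimal -/

section PosTwist

variable {l : ℕ} [Fact l.Prime]

/-- Divisors of a prime, in `ℤ`: `e ∣ ℓ` ⇒ `e ∈ {1, −1, ℓ, −ℓ}`. [folklore] -/
private theorem eq_of_dvd_prime_int {e : ℤ} (he : e ∣ (l : ℤ)) :
    e = 1 ∨ e = -1 ∨ e = l ∨ e = -(l : ℤ) := by
  have hl : l.Prime := Fact.out
  have h1 : e.natAbs ∣ l := Int.natAbs_dvd_natAbs.mpr (by simpa using he)
  rcases (Nat.dvd_prime hl).mp h1 with h | h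
  · rcases Int.natAbs_eq e with h' | h' <;> rw [h] at h' <;> simp [h']
  · rcases Int.natAbs_eq e with h' | h' <;> rw [h] at h' <;> simp [h']

/-- `(ℓ/7) = 1` for `ℓ ≡ 1 (mod 4)` with `(−7/ℓ) = 1`; hence `ℓ` is a non-zero square mod `7`, and `−ℓ`, `−1` are not.
[folklore] -/
private theorem zmod_seven_l_facts (hl4 : l % 4 = 1) (hl7 : legendreSym l (-7) = 1) (hl7' : l ≠ 7) :
    IsSquare ((l : ℤ) : ZMod 7) ∧ ¬ IsSquare ((-(l : ℤ) : ℤ) : ZMod 7) ∧ ¬ IsSquare ((-1 : ℤ) : ZMod 7) := by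
  haveI : Fact (Nat.Prime 7) := ⟨by norm_num⟩
  have hl : l.Prime := Fact.out
  have hl2 : l ≠ 2 := by rintro rfl; norm_num at hl4
  have hl07 : ((l : ℤ) : ZMod 7) ≠ 0 := by
    rw [Ne, ZMod.intCast_zmod_eq_zero_iff_dvd]
    intro h
    exact hl7' ((Nat.prime_dvd_prime_iff_eq (by norm_num) hl).mp (by exact_mod_cast h)).symm
  have h1 : legendreSym l (-1) = 1 := by rw [legendreSym.at_neg_one hl2, ZMod.χ₄_nat_one_mod_four hl4]
  have h7 : legendreSym l 7 = 1 := by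
    have hmul : legendreSym l (-7) = legendreSym l (-1) * legendreSym l 7 := by rw [← legendreSym.mul]; norm_num
    rwa [hmul, h1, one_mul] at hl7
  have h7l : legendreSym 7 l = 1 := by
    rw [legendreSym.quadratic_reciprocity_one_mod_four hl4 (by norm_num)]; exact_mod_cast h7
  have hsq : IsSquare ((l : ℤ) : ZMod 7) := (legendreSym.eq_one_iff 7 hl07).mp h7l
  have hm1' : ∀ r : ZMod 7, r * r ≠ -1 := zmod_seven_nonresidues_neg_one_neg_sq.1
  have hm1 : ¬ IsSquare ((-1 : ℤ) : ZMod 7) := by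
    rintro ⟨r, hr⟩; push_cast at hr; exact hm1' r hr.symm
  refine ⟨hsq, ?_, hm1⟩
  rintro ⟨r, hr⟩
  obtain ⟨q, hq⟩ := hsq
  push_cast at hq hr
  have hq0 : q ≠ 0 := by rintro rfl; exact hl07 (by push_cast; simpa using hq)
  refine hm1' (r / q) ?_
  rw [div_mul_div_comm, div_eq_iff (mul_ne_zero hq0 hq0)]
  linear_combination -hr - hq

/-- **`σ(ℓ) = −1` ⇒ `S(ℓ) ⊆ {1, 7}` and `S'(ℓ) ⊆ {1, −7}`** for a prime `ℓ ≡ 5 (mod 8)` with `(−7/ℓ) = 1`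
(here `σ(ℓ) = −1` is stated choice-free: `2(s − 21) ∉ 𝔽_ℓ²` for every `s` with `s² = −7`). Places used: `∞`
(negative definite), `2` (mod `16`), `7` (`S'`), `ℓ` (the split symbol). [cite: SilvermanAEC2009, Prop. X.4.9 and Example X.4.10] -/
theorem selmer_posTwist_subset_of_symbol_neg (hl8 : l % 8 = 5) (hl7 : legendreSym l (-7) = 1)
    (hσ : ∀ s : ZMod l, s ^ 2 = -7 → ¬ IsSquare (2 * (s - 21))) :
    twoIsogenySelmerGroup (21 * (l : ℤ)) (112 * (l : ℤ) ^ 2) ⊆ ({1, 7} : Finset ℤ) ∧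
      twoIsogenySelmerGroup (-42 * (l : ℤ)) (-7 * (l : ℤ) ^ 2) ⊆ ({1, -7} : Finset ℤ) := by
  have hl : l.Prime := Fact.out
  have hlp : Prime (l : ℤ) := Nat.prime_iff_prime_int.mp hl
  obtain ⟨hl2, hl7', hl4⟩ := prime_ne_two_ne_seven_of_mod_eight_five hl8
  have hl0 : (l : ℤ) ≠ 0 := by exact_mod_cast hl.ne_zero
  have hlpos : (0 : ℤ) < l := by exact_mod_cast hl.pos
  obtain ⟨s, t, hs, ht⟩ := exists_sq_eq_neg_seven_and_sq_eq_seven hl4 hl7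
  obtain ⟨hSl, hS7l, hS'l, hS'7l⟩ := ell_classes_not_mem_selmer_posTwist_of_symbol_neg hl2 hl7' hs ht (hσ s hs)
  have hM8 : ((l : ℤ)) % 8 = 5 := by omega
  have hlodd : Odd (l : ℤ) := by rw [Int.odd_iff]; omega
  have h7l : ¬ (7 : ℤ) ∣ (l : ℤ) := fun h =>
    hl7' ((Nat.prime_dvd_prime_iff_eq (by norm_num) hl).mp (by exact_mod_cast h)).symm
  refine ⟨?_, ?_⟩
  · -- S(ℓ) ⊆ {1, 7}
    intro d hd
    have hb : (112 * (l : ℤ) ^ 2 : ℤ) ≠ 0 := by positivity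
    have hd0 := hd
    rw [mem_twoIsogenySelmerGroup_iff hb] at hd
    obtain ⟨hsqf, ⟨d', hdd'⟩, hloc⟩ := hd
    have hd'eq : (112 * (l : ℤ) ^ 2 : ℤ) / d = d' := by rw [hdd', Int.mul_ediv_cancel_left _ hsqf.ne_zero]
    rw [hd'eq] at hloc
    obtain ⟨hreal, hpadic⟩ := hloc
    -- ∞ : d > 0
    have hdpos : 0 < d := by
      rcases lt_or_gt_of_ne hsqf.ne_zero with hneg | hpos
      · exfalso
        refine not_isSoluble_real_twoIsogenyQuartic_of_neg_of_sq_lt hneg ?_ hreal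
        nlinarith [sq_nonneg (l : ℤ), hlpos]
      · exact hpos
    -- d ∣ 14ℓ
    have h0 : d ∣ 112 * (l : ℤ) ^ 2 := ⟨d', hdd'⟩
    have h1 : d ∣ (14 * (l : ℤ)) ^ 4 := h0.trans ⟨343 * (l : ℤ) ^ 2, by ring⟩
    have h14l : d ∣ 14 * (l : ℤ) := (hsqf.dvd_pow_iff_dvd (by norm_num)).mp h1
    -- 2 : d odd
    have hdodd : ¬ (2 : ℤ) ∣ d := by
      rintro ⟨d₁, rfl⟩
      have hd₁e : ¬ Even d₁ := by
        rintro ⟨k, rfl⟩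
        exact Int.prime_two.not_unit (hsqf 2 ⟨k, by ring⟩)
      have hd₁ : Odd d₁ := Int.not_even_iff_odd.mp hd₁e
      have hcop : IsCoprime (8 : ℤ) d₁ := by
        have h2 : IsCoprime (2 : ℤ) d₁ :=
          (Int.prime_two.coprime_iff_not_dvd).mpr (by rwa [← even_iff_two_dvd])
        simpa using h2.pow_left (m := 3)
      have hprod : d₁ * d' = 8 * (7 * (l : ℤ) ^ 2) :=
        mul_left_cancel₀ (two_ne_zero : (2 : ℤ) ≠ 0) (by linear_combination -hdd')
      have h8 : (8 : ℤ) ∣ d' := hcop.dvd_of_dvd_mul_right ⟨7 * (l : ℤ) ^ 2, by rw [mul_comm]; exact hprod⟩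
      obtain ⟨e, rfl⟩ := h8
      have he : Odd e := by
        have hprod' : d₁ * e = 7 * (l : ℤ) ^ 2 :=
          mul_left_cancel₀ (by norm_num : (8 : ℤ) ≠ 0) (by linear_combination hprod)
        have hodd : Odd (d₁ * e) := by rw [hprod']; exact (by decide : Odd (7 : ℤ)).mul hlodd.pow
        exact (Int.odd_mul.mp hodd).2
      exact not_isSoluble_two_evenClass_of_mod_eight hM8 hd₁ he (hpadic 2)
    have h7ld : d ∣ 7 * (l : ℤ) := by
      have h' : d ∣ 2 * (7 * (l : ℤ)) := by rwa [show 2 * (7 * (l : ℤ)) = 14 * l by ring]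
      exact ((Int.prime_two.coprime_iff_not_dvd).mpr hdodd).symm.dvd_of_dvd_mul_left h'
    by_cases hld : (l : ℤ) ∣ d
    · exfalso
      obtain ⟨e, rfl⟩ := hld
      have he7 : e ∣ 7 := (mul_dvd_mul_iff_left hl0).mp (by simpa [mul_comm] using h7ld)
      have hepos : 0 < e := pos_of_mul_pos_right hdpos hlpos.le
      have hele : e ≤ 7 := Int.le_of_dvd (by norm_num) he7
      interval_cases e <;> first | omega | (exact hSl (by simpa using hd0)) |
        (exact hS7l (by simpa [mul_comm] using hd0))
    · have hcop : IsCoprime d (l : ℤ) := ((hlp.irreducible.coprime_iff_not_dvd).mpr hld).symm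
      have hd7 : d ∣ 7 := hcop.dvd_of_dvd_mul_right h7ld
      have hle : d ≤ 7 := Int.le_of_dvd (by norm_num) hd7
      interval_cases d <;> first | (exfalso; omega) | simp
  · -- S'(ℓ) ⊆ {1, −7}
    intro d hd
    have hb : (-7 * (l : ℤ) ^ 2 : ℤ) ≠ 0 := mul_ne_zero (by norm_num) (pow_ne_zero 2 hl0)
    have hd0 := hd
    rw [mem_twoIsogenySelmerGroup_iff hb] at hd
    obtain ⟨hsqf, ⟨d', hdd'⟩, -⟩ := hd
    have h2' : d ∣ (7 * (l : ℤ)) ^ 2 := ⟨-7 * d', by linear_combination (-7) * hdd'⟩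
    have h7l2 : d ∣ 7 * (l : ℤ) := (hsqf.dvd_pow_iff_dvd (by norm_num)).mp h2'
    obtain ⟨hsql, hnsql, hnsq1⟩ := zmod_seven_l_facts hl4 hl7 hl7'
    have hp7 : Prime (7 : ℤ) := by norm_num
    by_cases h7d : (7 : ℤ) ∣ d
    · obtain ⟨d₂, rfl⟩ := h7d
      have hd₂l : d₂ ∣ (l : ℤ) := (mul_dvd_mul_iff_left (by norm_num : (7 : ℤ) ≠ 0)).mp h7l2
      have h7d₂ : ¬ (7 : ℤ) ∣ d₂ := by
        rintro ⟨k, rfl⟩; exact hp7.not_unit (hsqf 7 ⟨k, by ring⟩)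
      have hsq := isSquare_neg_zmod_seven_of_seven_mul_mem_selmer' h7l h7d₂ hd0
      rcases eq_of_dvd_prime_int hd₂l with rfl | rfl | rfl | rfl
      · exact absurd hsq (by simpa using hnsq1)
      · simp
      · exact absurd hsq hnsql
      · exfalso; exact hS'7l (by simpa using hd0)
    · have hcop : IsCoprime d 7 := ((hp7.irreducible.coprime_iff_not_dvd).mpr h7d).symm
      have hdl : d ∣ (l : ℤ) := hcop.dvd_of_dvd_mul_left h7l2
      have hsq := isSquare_zmod_seven_of_mem_selmer' h7l h7d hd0
      rcases eq_of_dvd_prime_int hdl with rfl | rfl | rfl | rfl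
      · simp
      · exact absurd hsq hnsq1
      · exfalso; exact hS'l hd0
      · exact absurd hsq hnsql

end PosTwist


/-! ## §5. `σ(ℓ) = +1`: the Selmer sets of the auxiliary partner `49a1^{(aℓ)}` are minimal -/

section AuxTwist

variable {l : ℕ} [Fact l.Prime] {a : ℕ} [Fact a.Prime]

/-- **`σ(ℓ) = +1` ⇒ `S(aℓ) ⊆ {1, 7}` and `S'(aℓ) ⊆ {1, −7}`** for a prime `ℓ ≡ 5 (mod 8)` with `(−7/ℓ) = 1` and an
auxiliary prime `a ≡ 1 (mod 8)` INERT in `ℚ(√−7)` (`−7 ∉ 𝔽_a²`) with `a ∉ 𝔽_ℓ²` (i.e. `(a/ℓ) = −1`). Places: `∞`, `2`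
(`aℓ ≡ 5 (mod 8)`), `a` (the reduced quartics have discriminants `−7ℓ²`, `7·(16ℓ)²`, non-residues mod `a`), `7` (`S'`),
and `ℓ` (the split symbol, FLIPPED by `(a/ℓ) = −1`). Together with `selmer_posTwist_subset_of_symbol_neg`: exactly one of
`Sel₂(49a1^{(ℓ)})`, `Sel₂(49a1^{(aℓ)})` is minimal. [cite: SilvermanAEC2009, Prop. X.4.9 and Example X.4.10] -/
theorem selmer_auxTwist_subset_of_symbol_pos (hl8 : l % 8 = 5) (hl7 : legendreSym l (-7) = 1)
    (hσ : ∀ s : ZMod l, s ^ 2 = -7 → IsSquare (2 * (s - 21))) (ha8 : a % 8 = 1)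
    (ha7 : ¬ IsSquare ((-7 : ℤ) : ZMod a)) (hal : ¬ IsSquare ((a : ℤ) : ZMod l)) :
    twoIsogenySelmerGroup (21 * ((a : ℤ) * l)) (112 * ((a : ℤ) * l) ^ 2) ⊆ ({1, 7} : Finset ℤ) ∧
      twoIsogenySelmerGroup (-42 * ((a : ℤ) * l)) (-7 * ((a : ℤ) * l) ^ 2) ⊆ ({1, -7} : Finset ℤ) := by
  have hl : l.Prime := Fact.out
  have hap : a.Prime := Fact.out
  have hlp : Prime (l : ℤ) := Nat.prime_iff_prime_int.mp hl
  have haP : Prime (a : ℤ) := Nat.prime_iff_prime_int.mp hap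
  obtain ⟨hl2, hl7', hl4⟩ := prime_ne_two_ne_seven_of_mod_eight_five hl8
  have hl0 : (l : ℤ) ≠ 0 := by exact_mod_cast hl.ne_zero
  have ha0 : (a : ℤ) ≠ 0 := by exact_mod_cast hap.ne_zero
  have hlpos : (0 : ℤ) < l := by exact_mod_cast hl.pos
  have hapos : (0 : ℤ) < a := by exact_mod_cast hap.pos
  have ha2 : a ≠ 2 := by rintro rfl; norm_num at ha8
  have ha4 : a % 4 = 1 := by omega
  -- `a ≠ 7` (else `−7 ≡ 0` would be a square) and `a ∤ ℓ`, `ℓ ∤ a`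
  have ha7ne : a ≠ 7 := by rintro rfl; norm_num at ha8
  have hla : ¬ (l : ℤ) ∣ (a : ℤ) := by
    intro h; apply hal
    rw [(ZMod.intCast_zmod_eq_zero_iff_dvd (a : ℤ) l).mpr h]; exact ⟨0, by simp⟩
  have hal' : ¬ (a : ℤ) ∣ (l : ℤ) := by
    intro h
    have := (Nat.prime_dvd_prime_iff_eq hap hl).mp (by exact_mod_cast h)
    subst this; exact hla dvd_rfl
  have hlZa : ((l : ℤ) : ZMod a) ≠ 0 := by rwa [Ne, ZMod.intCast_zmod_eq_zero_iff_dvd]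
  obtain ⟨s, t, hs, ht⟩ := exists_sq_eq_neg_seven_and_sq_eq_seven hl4 hl7
  obtain ⟨hSl, hS7l, hS'l, hS'7l⟩ :=
    ell_classes_not_mem_selmer_auxTwist_of_symbol_pos hl2 hl7' hs ht (hσ s hs) (a₀ := (a : ℤ)) hla hal
  have hM8 : ((a : ℤ) * l) % 8 = 5 := by
    have ha' : (a : ℤ) % 8 = 1 := by omega
    have hl' : (l : ℤ) % 8 = 5 := by omega
    rw [Int.mul_emod, ha', hl']; norm_num
  have hModd : Odd ((a : ℤ) * l) := by rw [Int.odd_iff]; omega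
  have h7a : ¬ (7 : ℤ) ∣ (a : ℤ) := fun h =>
    ha7ne ((Nat.prime_dvd_prime_iff_eq (by norm_num) hap).mp (by exact_mod_cast h)).symm
  have h7l : ¬ (7 : ℤ) ∣ (l : ℤ) := fun h =>
    hl7' ((Nat.prime_dvd_prime_iff_eq (by norm_num) hl).mp (by exact_mod_cast h)).symm
  have h7M : ¬ (7 : ℤ) ∣ (a : ℤ) * l := fun h =>
    ((by norm_num : Prime (7 : ℤ)).dvd_or_dvd h).elim h7a h7l
  -- residues mod `a`: `−7ℓ²` and `7·(16ℓ)²` are non-squares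
  have hdiscS : ¬ IsSquare (((-7 * (l : ℤ) ^ 2 : ℤ)) : ZMod a) := not_isSquare_mul_sq_zmod hlZa ha7
  have hdiscS' : ¬ IsSquare (((7 * (16 * (l : ℤ)) ^ 2 : ℤ)) : ZMod a) := by
    refine not_isSquare_mul_sq_zmod ?_ (not_isSquare_seven_of_not_isSquare_neg_seven ha4 ha7)
    have hlZa' : (l : ZMod a) ≠ 0 := by exact_mod_cast hlZa
    have h2a : ((2 : ℕ) : ZMod a) ≠ 0 := by
      rw [Ne, ZMod.natCast_eq_zero_iff]; exact fun h => ha2 ((Nat.prime_dvd_prime_iff_eq hap Nat.prime_two).mp h)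
    have h16 : (16 : ZMod a) ≠ 0 := by
      have h : (16 : ZMod a) = ((2 : ℕ) : ZMod a) ^ 4 := by push_cast; norm_num
      rw [h]; exact pow_ne_zero _ h2a
    push_cast
    exact mul_ne_zero h16 hlZa'
  refine ⟨?_, ?_⟩
  · -- S(aℓ) ⊆ {1, 7}
    intro d hd
    have hb : (112 * ((a : ℤ) * l) ^ 2 : ℤ) ≠ 0 := by positivity
    have hd0 := hd
    rw [mem_twoIsogenySelmerGroup_iff hb] at hd
    obtain ⟨hsqf, ⟨d', hdd'⟩, hloc⟩ := hd
    have hd'eq : (112 * ((a : ℤ) * l) ^ 2 : ℤ) / d = d' := by rw [hdd', Int.mul_ediv_cancel_left _ hsqf.ne_zero]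
    rw [hd'eq] at hloc
    obtain ⟨hreal, hpadic⟩ := hloc
    have hdpos : 0 < d := by
      rcases lt_or_gt_of_ne hsqf.ne_zero with hneg | hpos
      · exfalso
        refine not_isSoluble_real_twoIsogenyQuartic_of_neg_of_sq_lt hneg ?_ hreal
        nlinarith [sq_nonneg ((a : ℤ) * l), mul_pos hapos hlpos]
      · exact hpos
    have h0 : d ∣ 112 * ((a : ℤ) * l) ^ 2 := ⟨d', hdd'⟩
    have h1 : d ∣ (14 * ((a : ℤ) * l)) ^ 4 := h0.trans ⟨343 * ((a : ℤ) * l) ^ 2, by ring⟩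
    have h14 : d ∣ 14 * ((a : ℤ) * l) := (hsqf.dvd_pow_iff_dvd (by norm_num)).mp h1
    -- 2
    have hdodd : ¬ (2 : ℤ) ∣ d := by
      rintro ⟨d₁, rfl⟩
      have hd₁e : ¬ Even d₁ := by
        rintro ⟨k, rfl⟩
        exact Int.prime_two.not_unit (hsqf 2 ⟨k, by ring⟩)
      have hd₁ : Odd d₁ := Int.not_even_iff_odd.mp hd₁e
      have hcop : IsCoprime (8 : ℤ) d₁ := by
        have h2 : IsCoprime (2 : ℤ) d₁ :=
          (Int.prime_two.coprime_iff_not_dvd).mpr (by rwa [← even_iff_two_dvd])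
        simpa using h2.pow_left (m := 3)
      have hprod : d₁ * d' = 8 * (7 * ((a : ℤ) * l) ^ 2) :=
        mul_left_cancel₀ (two_ne_zero : (2 : ℤ) ≠ 0) (by linear_combination -hdd')
      have h8 : (8 : ℤ) ∣ d' := hcop.dvd_of_dvd_mul_right ⟨7 * ((a : ℤ) * l) ^ 2, by rw [mul_comm]; exact hprod⟩
      obtain ⟨e, rfl⟩ := h8
      have he : Odd e := by
        have hprod' : d₁ * e = 7 * ((a : ℤ) * l) ^ 2 :=
          mul_left_cancel₀ (by norm_num : (8 : ℤ) ≠ 0) (by linear_combination hprod)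
        have hodd : Odd (d₁ * e) := by rw [hprod']; exact (by decide : Odd (7 : ℤ)).mul hModd.pow
        exact (Int.odd_mul.mp hodd).2
      exact not_isSoluble_two_evenClass_of_mod_eight hM8 hd₁ he (hpadic 2)
    -- a
    have hada : ¬ (a : ℤ) ∣ d := by
      rintro ⟨d₃, rfl⟩
      have had₃ : ¬ (a : ℤ) ∣ d₃ := by
        rintro ⟨k, rfl⟩; exact haP.not_unit (hsqf a ⟨k, by ring⟩)
      -- d' = a e₀ with d₃ e₀ = 112 ℓ²
      have hprod : d₃ * d' = (a : ℤ) * (112 * (l : ℤ) ^ 2) :=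
        mul_left_cancel₀ ha0 (by linear_combination -hdd')
      have hcop : IsCoprime (a : ℤ) d₃ := (haP.coprime_iff_not_dvd).mpr had₃
      obtain ⟨e₀, rfl⟩ : (a : ℤ) ∣ d' := hcop.dvd_of_dvd_mul_right ⟨112 * (l : ℤ) ^ 2, by rw [mul_comm]; exact hprod⟩
      have he₀ : d₃ * e₀ = 112 * (l : ℤ) ^ 2 := mul_left_cancel₀ ha0 (by linear_combination hprod)
      have hxy : (d₃ : ZMod a) * e₀ = 112 * (l : ZMod a) ^ 2 := by exact_mod_cast congrArg (Int.cast : ℤ → ZMod a) he₀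
      have hdisc : ¬ IsSquare ((21 * (l : ZMod a)) ^ 2 - 4 * (d₃ : ZMod a) * e₀) := by
        have e1 : (21 * (l : ZMod a)) ^ 2 - 4 * (d₃ : ZMod a) * e₀ = ((-7 * (l : ℤ) ^ 2 : ℤ) : ZMod a) := by
          push_cast; linear_combination (-4) * hxy
        rw [e1]; exact hdiscS
      have hdisc' : ¬ IsSquare ((21 * (l : ZMod a)) ^ 2 - 4 * (e₀ : ZMod a) * d₃) := by
        rwa [show 4 * (e₀ : ZMod a) * d₃ = 4 * (d₃ : ZMod a) * e₀ by ring]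
      refine not_isSoluble_padic_of_forall_quartic_ne_zero (p := a) (c := 21 * (l : ℤ)) (d₀ := d₃) (e₀ := e₀)
        (by ring) rfl rfl ?_ ?_ (hpadic a)
      · intro τ; push_cast; exact forall_quartic_ne_zero_of_disc_not_isSquare hdisc τ
      · intro τ; push_cast; exact forall_quartic_ne_zero_of_disc_not_isSquare hdisc' τ
    have h14l : d ∣ 14 * (l : ℤ) := by
      have h' : d ∣ (a : ℤ) * (14 * l) := by rwa [show (a : ℤ) * (14 * l) = 14 * (a * l) by ring]
      exact ((haP.coprime_iff_not_dvd).mpr hada).symm.dvd_of_dvd_mul_left h'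
    have h7ld : d ∣ 7 * (l : ℤ) := by
      have h' : d ∣ 2 * (7 * (l : ℤ)) := by rwa [show 2 * (7 * (l : ℤ)) = 14 * l by ring]
      exact ((Int.prime_two.coprime_iff_not_dvd).mpr hdodd).symm.dvd_of_dvd_mul_left h'
    by_cases hld : (l : ℤ) ∣ d
    · exfalso
      obtain ⟨e, rfl⟩ := hld
      have he7 : e ∣ 7 := (mul_dvd_mul_iff_left hl0).mp (by simpa [mul_comm] using h7ld)
      have hepos : 0 < e := pos_of_mul_pos_right hdpos hlpos.le
      have hele : e ≤ 7 := Int.le_of_dvd (by norm_num) he7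
      interval_cases e <;> first | omega | (exact hSl (by simpa using hd0)) |
        (exact hS7l (by simpa [mul_comm] using hd0))
    · have hcop : IsCoprime d (l : ℤ) := ((hlp.irreducible.coprime_iff_not_dvd).mpr hld).symm
      have hd7 : d ∣ 7 := hcop.dvd_of_dvd_mul_right h7ld
      have hle : d ≤ 7 := Int.le_of_dvd (by norm_num) hd7
      interval_cases d <;> first | (exfalso; omega) | simp
  · -- S'(aℓ) ⊆ {1, −7}
    intro d hd
    have hb : (-7 * ((a : ℤ) * l) ^ 2 : ℤ) ≠ 0 := mul_ne_zero (by norm_num) (pow_ne_zero 2 (mul_ne_zero ha0 hl0))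
    have hd0 := hd
    rw [mem_twoIsogenySelmerGroup_iff hb] at hd
    obtain ⟨hsqf, ⟨d', hdd'⟩, hloc⟩ := hd
    have hd'eq : (-7 * ((a : ℤ) * l) ^ 2 : ℤ) / d = d' := by rw [hdd', Int.mul_ediv_cancel_left _ hsqf.ne_zero]
    rw [hd'eq] at hloc
    obtain ⟨-, hpadic⟩ := hloc
    have h2' : d ∣ (7 * ((a : ℤ) * l)) ^ 2 := ⟨-7 * d', by linear_combination (-7) * hdd'⟩
    have h7al : d ∣ 7 * ((a : ℤ) * l) := (hsqf.dvd_pow_iff_dvd (by norm_num)).mp h2'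
    -- a
    have hada : ¬ (a : ℤ) ∣ d := by
      rintro ⟨d₃, rfl⟩
      have had₃ : ¬ (a : ℤ) ∣ d₃ := by
        rintro ⟨k, rfl⟩; exact haP.not_unit (hsqf a ⟨k, by ring⟩)
      have hprod : d₃ * d' = (a : ℤ) * (-7 * (l : ℤ) ^ 2) :=
        mul_left_cancel₀ ha0 (by linear_combination -hdd')
      have hcop : IsCoprime (a : ℤ) d₃ := (haP.coprime_iff_not_dvd).mpr had₃
      obtain ⟨e₀, rfl⟩ : (a : ℤ) ∣ d' := hcop.dvd_of_dvd_mul_right ⟨-7 * (l : ℤ) ^ 2, by rw [mul_comm]; exact hprod⟩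
      have he₀ : d₃ * e₀ = -7 * (l : ℤ) ^ 2 := mul_left_cancel₀ ha0 (by linear_combination hprod)
      have hxy : (d₃ : ZMod a) * e₀ = -7 * (l : ZMod a) ^ 2 := by exact_mod_cast congrArg (Int.cast : ℤ → ZMod a) he₀
      have hdisc : ¬ IsSquare ((-42 * (l : ZMod a)) ^ 2 - 4 * (d₃ : ZMod a) * e₀) := by
        have e1 : (-42 * (l : ZMod a)) ^ 2 - 4 * (d₃ : ZMod a) * e₀ = ((7 * (16 * (l : ℤ)) ^ 2 : ℤ) : ZMod a) := by
          push_cast; linear_combination (-4) * hxy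
        rw [e1]; exact hdiscS'
      have hdisc' : ¬ IsSquare ((-42 * (l : ZMod a)) ^ 2 - 4 * (e₀ : ZMod a) * d₃) := by
        rwa [show 4 * (e₀ : ZMod a) * d₃ = 4 * (d₃ : ZMod a) * e₀ by ring]
      refine not_isSoluble_padic_of_forall_quartic_ne_zero (p := a) (c := -42 * (l : ℤ)) (d₀ := d₃) (e₀ := e₀)
        (by ring) rfl rfl ?_ ?_ (hpadic a)
      · intro τ; push_cast; exact forall_quartic_ne_zero_of_disc_not_isSquare hdisc τ
      · intro τ; push_cast; exact forall_quartic_ne_zero_of_disc_not_isSquare hdisc' τ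
    have h7l2 : d ∣ 7 * (l : ℤ) := by
      have h' : d ∣ (a : ℤ) * (7 * l) := by rwa [show (a : ℤ) * (7 * l) = 7 * (a * l) by ring]
      exact ((haP.coprime_iff_not_dvd).mpr hada).symm.dvd_of_dvd_mul_left h'
    obtain ⟨hsql, hnsql, hnsq1⟩ := zmod_seven_l_facts hl4 hl7 hl7'
    have hp7 : Prime (7 : ℤ) := by norm_num
    by_cases h7d : (7 : ℤ) ∣ d
    · obtain ⟨d₂, rfl⟩ := h7d
      have hd₂l : d₂ ∣ (l : ℤ) := (mul_dvd_mul_iff_left (by norm_num : (7 : ℤ) ≠ 0)).mp h7l2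
      have h7d₂ : ¬ (7 : ℤ) ∣ d₂ := by
        rintro ⟨k, rfl⟩; exact hp7.not_unit (hsqf 7 ⟨k, by ring⟩)
      have hsq := isSquare_neg_zmod_seven_of_seven_mul_mem_selmer' h7M h7d₂ hd0
      rcases eq_of_dvd_prime_int hd₂l with rfl | rfl | rfl | rfl
      · exact absurd hsq (by simpa using hnsq1)
      · simp
      · exact absurd hsq hnsql
      · exfalso; exact hS'7l (by simpa using hd0)
    · have hcop : IsCoprime d 7 := ((hp7.irreducible.coprime_iff_not_dvd).mpr h7d).symm
      have hdl : d ∣ (l : ℤ) := hcop.dvd_of_dvd_mul_left h7l2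
      have hsq := isSquare_zmod_seven_of_mem_selmer' h7M h7d hd0
      rcases eq_of_dvd_prime_int hdl with rfl | rfl | rfl | rfl
      · simp
      · exact absurd hsq hnsq1
      · exfalso; exact hS'l hd0
      · exact absurd hsq hnsql

end AuxTwist

end Summit.BirchSwinnertonDyer.BirchSwinnertonDyer.Theorems.GoldfeldGoodTwists

end
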